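import Literature.NumberTheory.Transcendental.ConjugateRechart
import Literature.Geometry.Kaehler.ManifoldFormsPullback
import HarnessLib

/-!
# The conjugate complex structure exchanges the form types `(p,q) ↔ (q,p)` and the Hodge subspaces `H^{p,q} ↔ H^{q,p}`

Layer `Literature/NumberTheory/Transcendental`; sequel of `ConjugateRechart` (the conjugate complex manifold
`M̄ = Rechart L.toHomeomorph M` of a complex manifold `M` charted on `E`, `L : E ≃L[ℝ] E` antilinear; the identity maps `out : M̄ → M`,
`into : M → M̄` are real `C^∞` with antilinear differentials `L⁻¹`, `L`).  Cell hodgecm-mathlib, floor 0, kernel K-A1 of the named fact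
`HodgeTheory.ConjEmbedding.isOfHodgeType_conj_iff`.  Printed content: C. Voisin, *Hodge Theory and Complex Algebraic Geometry I* (2002),
§2.3.1 and §6.1.2–6.1.3: the type `(p,q)` of a form is defined by the complex structure; for the CONJUGATE complex structure a `(p,q)`-form of
`X` is a `(q,p)`-form, so `H^{p,q}(X̄) = H^{q,p}(X)` inside the common complex de Rham cohomology of the underlying real manifold, and the
Hodge decomposition of `X` is that of `X̄` with `p` and `q` exchanged.

* `IsOfType.pullback_of_antilinear` — the pull-back of a form of type `(p,q)` along a real `C^1` map whose differential reverses the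
  rotations (`df (e^{iθ} v) = e^{-iθ} df(v)`, i.e. is antilinear) is of type `(q,p)`; `IsOfType.pullback_out/into` for `M̄`;
* `hodgePQ_map_le_of_antilinear`, `hodgePQ_map_eq_of_antilinear` — `f^* H^{p,q}(N) ⊆ H^{q,p}(M)` for `f` antiholomorphic, with equality
  for an antiholomorphic diffeomorphism; `hodgePQ_map_out_eq`: `out^* H^{p,q}(M) = H^{q,p}(M̄)` (Voisin §6.1.2);
* `isInternal_hodgePQ_rechart` — the Hodge decomposition of `M` transports to `M̄`;
* `mdifferentiableWithinAt_conj_comp_out`, `mdifferentiableOn_conj_comp_out` — for `g` holomorphic on `M`, `conj ∘ g ∘ out` is holomorphic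
  on `M̄` (used to make `M̄` the analytification of the conjugate variety, file `HodgeTheory/HodgeTypeConjugateEmbeddingHolds`).

Everything is a theorem; no definition, no named fact, no `sorry`.  HC_CM (cell hodgecm-mathlib) is proved only modulo its printed
citations until rung 0 closes; this file discharges none of them by itself.

## References
* [VoisinHodgeI2002] C. Voisin, *Hodge Theory and Complex Algebraic Geometry I*, CUP 2002, §2.3.1, §6.1.2–6.1.3, §7.3.2.
* [Deligne1982HodgeCycles] P. Deligne, *Hodge cycles on abelian varieties*, LNM 900 (1982), §1 (p. 7).
-/

noncomputable section

open scoped Manifold ContDiff Topology ComplexConjugate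
open Set Function Literature.Geometry.Manifold

namespace Literature.NumberTheory.Transcendental

/-! ## §4 Pull-back along an antiholomorphic map exchanges the types `(p,q)` and `(q,p)` -/

section Types

variable {E : Type*} [NormedAddCommGroup E] [NormedSpace ℂ E] {M : Type*} [TopologicalSpace M] [ChartedSpace E M]
  {E' : Type*} [NormedAddCommGroup E'] [NormedSpace ℂ E'] {N : Type*} [TopologicalSpace N] [ChartedSpace E' N]
  {k p q : ℕ}

/-- **The pull-back of a form of type `(p,q)` along an ANTIholomorphic map is of type `(q,p)`**: if the real differential of `f`
reverses the rotations, `df (e^{iθ}v) = e^{-iθ} df(v)` (it is antilinear), then `(f^*α)(e^{iθ}v) = α(e^{-iθ} df v) = e^{-i(p-q)θ}(f^*α)(v)`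
([VoisinHodgeI2002] §2.3.1 and §6.1.2: conjugating the complex structure exchanges `T^{1,0}` and `T^{0,1}`; compare the holomorphic case
`IsOfType.pullback`). [cite: VoisinHodgeI2002, §6.1.2] -/
theorem IsOfType.pullback_of_antilinear {α : Literature.Geometry.Kaehler.MForm 𝓘(ℝ, E') N ℂ k} (hα : IsOfType p q α) {f : M → N}
    (hf : ∀ (x : M) (θ : ℝ) (w : TangentSpace 𝓘(ℝ, E) x),
      mfderiv 𝓘(ℝ, E) 𝓘(ℝ, E') f x (tangentRotate E x θ w) = tangentRotate E' (f x) (-θ) (mfderiv 𝓘(ℝ, E) 𝓘(ℝ, E') f x w)) :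
    IsOfType q p (α.pullback 𝓘(ℝ, E) f) := by
  refine ⟨by rw [add_comm]; exact hα.1, fun x θ v ↦ ?_⟩
  simp only [Literature.Geometry.Kaehler.MForm.pullback_apply, hf]
  rw [hα.2 (f x) (-θ) _]
  congr 1
  push_cast
  ring_nf

variable (L : E ≃L[ℝ] E) (hL : ∀ (c : ℂ) (v : E), L (c • v) = conj c • L v)
include hL

/-- The differential `L⁻¹` of `out : M̄ → M` reverses rotations. [cite: VoisinHodgeI2002, §6.1.2] -/
theorem Rechart.mfderiv_out_tangentRotate (x : Rechart L.toHomeomorph M) (θ : ℝ) (w : TangentSpace 𝓘(ℝ, E) x) :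
    mfderiv 𝓘(ℝ, E) 𝓘(ℝ, E) (Rechart.out L.toHomeomorph M) x (tangentRotate E x θ w) =
      tangentRotate E (Rechart.out L.toHomeomorph M x) (-θ) (mfderiv 𝓘(ℝ, E) 𝓘(ℝ, E) (Rechart.out L.toHomeomorph M) x w) := by
  rw [Rechart.mfderiv_out_linear, tangentRotate_apply, tangentRotate_apply]
  exact antilinear_exp_smul L.symm (antilinear_symm L hL) θ w

/-- The differential `L` of `into : M → M̄` reverses rotations. [cite: VoisinHodgeI2002, §6.1.2] -/
theorem Rechart.mfderiv_into_tangentRotate (x : M) (θ : ℝ) (w : TangentSpace 𝓘(ℝ, E) x) :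
    mfderiv 𝓘(ℝ, E) 𝓘(ℝ, E) (Rechart.into L.toHomeomorph M) x (tangentRotate E x θ w) =
      tangentRotate E (Rechart.into L.toHomeomorph M x) (-θ) (mfderiv 𝓘(ℝ, E) 𝓘(ℝ, E) (Rechart.into L.toHomeomorph M) x w) := by
  rw [Rechart.mfderiv_into_linear, tangentRotate_apply, tangentRotate_apply]
  exact antilinear_exp_smul L hL θ w

/-- `out^*` maps `(p,q)`-forms of `M` to `(q,p)`-forms of `M̄`. [cite: VoisinHodgeI2002, §6.1.2] -/
theorem IsOfType.pullback_out {α : Literature.Geometry.Kaehler.MForm 𝓘(ℝ, E) M ℂ k} (hα : IsOfType p q α) :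
    IsOfType q p (α.pullback 𝓘(ℝ, E) (Rechart.out L.toHomeomorph M)) :=
  hα.pullback_of_antilinear (Rechart.mfderiv_out_tangentRotate L hL)

/-- `into^*` maps `(p,q)`-forms of `M̄` to `(q,p)`-forms of `M`. [cite: VoisinHodgeI2002, §6.1.2] -/
theorem IsOfType.pullback_into {α : Literature.Geometry.Kaehler.MForm 𝓘(ℝ, E) (Rechart L.toHomeomorph M) ℂ k}
    (hα : IsOfType p q α) : IsOfType q p (α.pullback 𝓘(ℝ, E) (Rechart.into L.toHomeomorph M)) :=
  hα.pullback_of_antilinear (Rechart.mfderiv_into_tangentRotate L hL)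

end Types

/-! ## §5 `H^{p,q}(M̄) = H^{q,p}(M)` and the Hodge decomposition of `M̄` -/

section Cohomology

variable {E : Type*} [NormedAddCommGroup E] [NormedSpace ℂ E] {M : Type*} [TopologicalSpace M] [ChartedSpace E M]
  {E' : Type*} [NormedAddCommGroup E'] [NormedSpace ℂ E'] {N : Type*} [TopologicalSpace N] [ChartedSpace E' N]
  [IsManifold 𝓘(ℝ, E) ∞ M] [IsManifold 𝓘(ℝ, E') ∞ N]

/-- **`f^*` maps `H^{p,q}(N)` into `H^{q,p}(M)` for `f` antiholomorphic** (real `C^∞` with rotation-reversing differential): the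
span of classes of closed `(p,q)`-forms goes to the span of classes of closed `(q,p)`-forms (`IsOfType.pullback_of_antilinear`;
[VoisinHodgeI2002] §6.1.2 with §7.3.2). [cite: VoisinHodgeI2002, §6.1.2] -/
theorem hodgePQ_map_le_of_antilinear [PullbackFacts 𝓘(ℝ, E) M 𝓘(ℝ, E') N ℂ] {f : M → N}
    (hf : ContMDiff 𝓘(ℝ, E) 𝓘(ℝ, E') ∞ f)
    (hf' : ∀ (x : M) (θ : ℝ) (w : TangentSpace 𝓘(ℝ, E) x),
      mfderiv 𝓘(ℝ, E) 𝓘(ℝ, E') f x (tangentRotate E x θ w) = tangentRotate E' (f x) (-θ) (mfderiv 𝓘(ℝ, E) 𝓘(ℝ, E') f x w))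
    (k p q : ℕ) :
    (hodgePQ E' N k p q).map (complexDeRhamCohomology.map E hf k) ≤ hodgePQ E M k q p := by
  rw [hodgePQ, Submodule.map_span_le]
  rintro _ ⟨α, hα, rfl⟩
  rw [complexDeRhamCohomology.map_mk]
  exact Submodule.subset_span ⟨_, IsOfType.pullback_of_antilinear hα hf', rfl⟩

/-- **An antiholomorphic diffeomorphism identifies `H^{p,q}(N)` with `H^{q,p}(M)`**: `f^*(H^{p,q}(N)) = H^{q,p}(M)` when `f`, `g` are
mutually inverse antiholomorphic real `C^∞` maps (both inclusions are `hodgePQ_map_le_of_antilinear`, and `f^* ∘ g^* = id`).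
[cite: VoisinHodgeI2002, §6.1.2] -/
theorem hodgePQ_map_eq_of_antilinear [PullbackFacts 𝓘(ℝ, E) M 𝓘(ℝ, E') N ℂ] [PullbackFacts 𝓘(ℝ, E') N 𝓘(ℝ, E) M ℂ]
    [PullbackFacts 𝓘(ℝ, E) M 𝓘(ℝ, E) M ℂ] {f : M → N} {g : N → M}
    (hf : ContMDiff 𝓘(ℝ, E) 𝓘(ℝ, E') ∞ f)
    (hf' : ∀ (x : M) (θ : ℝ) (w : TangentSpace 𝓘(ℝ, E) x),
      mfderiv 𝓘(ℝ, E) 𝓘(ℝ, E') f x (tangentRotate E x θ w) = tangentRotate E' (f x) (-θ) (mfderiv 𝓘(ℝ, E) 𝓘(ℝ, E') f x w))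
    (hg : ContMDiff 𝓘(ℝ, E') 𝓘(ℝ, E) ∞ g)
    (hg' : ∀ (y : N) (θ : ℝ) (w : TangentSpace 𝓘(ℝ, E') y),
      mfderiv 𝓘(ℝ, E') 𝓘(ℝ, E) g y (tangentRotate E' y θ w) = tangentRotate E (g y) (-θ) (mfderiv 𝓘(ℝ, E') 𝓘(ℝ, E) g y w))
    (hgf : Function.LeftInverse g f) (k p q : ℕ) :
    (hodgePQ E' N k p q).map (complexDeRhamCohomology.map E hf k) = hodgePQ E M k q p := by
  refine le_antisymm (hodgePQ_map_le_of_antilinear hf hf' k p q) fun c hc ↦ ?_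
  refine ⟨complexDeRhamCohomology.map E' hg k c, hodgePQ_map_le_of_antilinear hg hg' k q p (Submodule.mem_map_of_mem hc), ?_⟩
  change (complexDeRhamCohomology.map E hf k ∘ₗ complexDeRhamCohomology.map E' hg k) c = c
  rw [← complexDeRhamCohomology.map_comp hg hf,
    complexDeRhamCohomology.map_congr (hg.comp hf) contMDiff_id (funext hgf) k, complexDeRhamCohomology.map_id]
  rfl

variable (L : E ≃L[ℝ] E) [IsManifold 𝓘(ℝ, E) ∞ (Rechart L.toHomeomorph M)]

/-- `into^* ∘ out^* = id` on `H^k_dR(M; ℂ)` (functoriality of the pull-back). [cite: VoisinHodgeI2002, §6.1.2] -/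
theorem complexDeRhamCohomology.map_into_map_out (k : ℕ) (c : complexDeRhamCohomology E M k) :
    complexDeRhamCohomology.map E (Rechart.contMDiff_into_linear (M := M) L) k
      (complexDeRhamCohomology.map E (Rechart.contMDiff_out_linear (M := M) L) k c) = c := by
  change (complexDeRhamCohomology.map E (Rechart.contMDiff_into_linear (M := M) L) k ∘ₗ
    complexDeRhamCohomology.map E (Rechart.contMDiff_out_linear (M := M) L) k) c = c
  rw [← complexDeRhamCohomology.map_comp (Rechart.contMDiff_out_linear L) (Rechart.contMDiff_into_linear L),
    complexDeRhamCohomology.map_congr ((Rechart.contMDiff_out_linear L).comp (Rechart.contMDiff_into_linear L)) contMDiff_id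
      (funext fun _ ↦ rfl) k, complexDeRhamCohomology.map_id]
  rfl

/-- `out^* ∘ into^* = id` on `H^k_dR(M̄; ℂ)` (functoriality of the pull-back). [cite: VoisinHodgeI2002, §6.1.2] -/
theorem complexDeRhamCohomology.map_out_map_into (k : ℕ) (c : complexDeRhamCohomology E (Rechart L.toHomeomorph M) k) :
    complexDeRhamCohomology.map E (Rechart.contMDiff_out_linear (M := M) L) k
      (complexDeRhamCohomology.map E (Rechart.contMDiff_into_linear (M := M) L) k c) = c := by
  change (complexDeRhamCohomology.map E (Rechart.contMDiff_out_linear (M := M) L) k ∘ₗ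
    complexDeRhamCohomology.map E (Rechart.contMDiff_into_linear (M := M) L) k) c = c
  rw [← complexDeRhamCohomology.map_comp (Rechart.contMDiff_into_linear L) (Rechart.contMDiff_out_linear L),
    complexDeRhamCohomology.map_congr ((Rechart.contMDiff_into_linear L).comp (Rechart.contMDiff_out_linear L)) contMDiff_id
      (funext fun _ ↦ rfl) k, complexDeRhamCohomology.map_id]
  rfl

variable (hL : ∀ (c : ℂ) (v : E), L (c • v) = conj c • L v)
include hL

/-- **`H^{p,q}` of the conjugate manifold**: `out^*(H^{p,q}(M)) = H^{q,p}(M̄)` in complex de Rham cohomology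
([VoisinHodgeI2002] §6.1.2: `H^{p,q}(X̄) = H^{q,p}(X)`). [cite: VoisinHodgeI2002, §6.1.2] -/
theorem hodgePQ_map_out_eq (k p q : ℕ) :
    (hodgePQ E M k p q).map (complexDeRhamCohomology.map E (Rechart.contMDiff_out_linear (M := M) L) k) =
      hodgePQ E (Rechart L.toHomeomorph M) k q p :=
  hodgePQ_map_eq_of_antilinear (Rechart.contMDiff_out_linear L) (Rechart.mfderiv_out_tangentRotate L hL)
    (Rechart.contMDiff_into_linear L) (Rechart.mfderiv_into_tangentRotate L hL) (fun _ ↦ rfl) k p q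

/-- `into^*(H^{p,q}(M̄)) = H^{q,p}(M)`. [cite: VoisinHodgeI2002, §6.1.2] -/
theorem hodgePQ_map_into_eq (k p q : ℕ) :
    (hodgePQ E (Rechart L.toHomeomorph M) k p q).map (complexDeRhamCohomology.map E (Rechart.contMDiff_into_linear (M := M) L) k) =
      hodgePQ E M k q p :=
  hodgePQ_map_eq_of_antilinear (Rechart.contMDiff_into_linear L) (Rechart.mfderiv_into_tangentRotate L hL)
    (Rechart.contMDiff_out_linear L) (Rechart.mfderiv_out_tangentRotate L hL) (fun _ ↦ rfl) k p q

/-- **The Hodge decomposition transports to the conjugate manifold** with `(p,q) ↦ (q,p)`: if `H^k_dR(M; ℂ) = ⨁_{p+q=k} H^{p,q}(M)`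
then `H^k_dR(M̄; ℂ) = ⨁_{p+q=k} H^{p,q}(M̄)`, since `out^*` is a linear isomorphism carrying `H^{q,p}(M)` onto `H^{p,q}(M̄)`
([VoisinHodgeI2002] §6.1.2–6.1.3). [cite: VoisinHodgeI2002, §6.1.2–6.1.3] -/
theorem isInternal_hodgePQ_rechart {k : ℕ}
    (h : DirectSum.IsInternal fun pq : ↥(Finset.HasAntidiagonal.antidiagonal k) ↦ hodgePQ E M k pq.1.1 pq.1.2) :
    DirectSum.IsInternal fun pq : ↥(Finset.HasAntidiagonal.antidiagonal k) ↦ hodgePQ E (Rechart L.toHomeomorph M) k pq.1.1 pq.1.2 := by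
  -- the linear isomorphism `out^*`
  let T : complexDeRhamCohomology E M k ≃ₗ[ℂ] complexDeRhamCohomology E (Rechart L.toHomeomorph M) k :=
    LinearEquiv.ofLinear (complexDeRhamCohomology.map E (Rechart.contMDiff_out_linear (M := M) L) k)
      (complexDeRhamCohomology.map E (Rechart.contMDiff_into_linear (M := M) L) k)
      (LinearMap.ext (complexDeRhamCohomology.map_out_map_into L k))
      (LinearMap.ext (complexDeRhamCohomology.map_into_map_out L k))
  -- the swap of the antidiagonal
  let σ : ↥(Finset.HasAntidiagonal.antidiagonal k) → ↥(Finset.HasAntidiagonal.antidiagonal k) := fun pq ↦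
    ⟨(pq.1.2, pq.1.1), by rw [Finset.HasAntidiagonal.mem_antidiagonal, add_comm]; exact Finset.HasAntidiagonal.mem_antidiagonal.1 pq.2⟩
  have hσσ : ∀ pq, σ (σ pq) = pq := fun pq ↦ Subtype.ext rfl
  have hσ : Function.Bijective σ := Function.Involutive.bijective hσσ
  have hT : ∀ pq : ↥(Finset.HasAntidiagonal.antidiagonal k),
      hodgePQ E (Rechart L.toHomeomorph M) k pq.1.1 pq.1.2 = (hodgePQ E M k (σ pq).1.1 (σ pq).1.2).map T.toLinearMap := fun pq ↦
    (hodgePQ_map_out_eq L hL k pq.1.2 pq.1.1).symm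
  rw [DirectSum.isInternal_submodule_iff_iSupIndep_and_iSup_eq_top] at h ⊢
  obtain ⟨hind, htop⟩ := h
  constructor
  · have h1 : iSupIndep fun pq : ↥(Finset.HasAntidiagonal.antidiagonal k) ↦ (hodgePQ E M k (σ pq).1.1 (σ pq).1.2).map T.toLinearMap := by
      have h2 := (hind.comp hσ.injective).map_orderIso (Submodule.orderIsoMapComap T)
      exact h2
    simpa only [hT] using h1
  · simp only [hT]
    rw [← Submodule.map_iSup, hσ.2.iSup_comp (fun pq : ↥(Finset.HasAntidiagonal.antidiagonal k) ↦ hodgePQ E M k pq.1.1 pq.1.2), htop,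
      Submodule.map_top, LinearEquiv.range]

end Cohomology

/-! ## §6 Holomorphic functions on `M` conjugate to holomorphic functions on `M̄` -/

section Holomorphic

variable {E : Type*} [NormedAddCommGroup E] [NormedSpace ℂ E] {M : Type*} [TopologicalSpace M] [ChartedSpace E M]
  (L : E ≃L[ℝ] E) (hL : ∀ (c : ℂ) (v : E), L (c • v) = conj c • L v)
include hL

/-- **`conj ∘ g ∘ out` is holomorphic on `M̄` where `g` is holomorphic on `M`**: in the charts `L ∘ c` of `M̄` it reads
`conj ∘ (g ∘ c⁻¹) ∘ L⁻¹`, complex-differentiable by `DifferentiableWithinAt.antilinear_conj` ([VoisinHodgeI2002] §6.1.2: the holomorphic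
functions of `X̄` are the conjugates of those of `X`). [cite: VoisinHodgeI2002, §6.1.2] -/
theorem mdifferentiableWithinAt_conj_comp_out {g : M → ℂ} {s : Set M} {x : Rechart L.toHomeomorph M}
    (hg : MDifferentiableWithinAt 𝓘(ℂ, E) 𝓘(ℂ, ℂ) g s (Rechart.out L.toHomeomorph M x)) :
    MDifferentiableWithinAt 𝓘(ℂ, E) 𝓘(ℂ, ℂ) (starRingEnd ℂ ∘ g ∘ Rechart.out L.toHomeomorph M)
      (Rechart.out L.toHomeomorph M ⁻¹' s) x := by
  rw [mdifferentiableWithinAt_iff] at hg ⊢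
  obtain ⟨hgc, hgd⟩ := hg
  refine ⟨Complex.continuous_conj.continuousWithinAt.comp (hgc.comp (Rechart.continuous_out _ M).continuousWithinAt
    (mapsTo_preimage _ _)) (mapsTo_univ _ _), ?_⟩
  -- the written map of `g` at `out x` is `g ∘ c.symm`, differentiable within `c.symm ⁻¹' s` at `c (out x)`
  have hgd' : DifferentiableWithinAt ℂ (g ∘ (chartAt E (Rechart.out L.toHomeomorph M x)).symm)
      ((chartAt E (Rechart.out L.toHomeomorph M x)).symm ⁻¹' s)
      (chartAt E (Rechart.out L.toHomeomorph M x) (Rechart.out L.toHomeomorph M x)) := by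
    have e1 : extChartAt 𝓘(ℂ, ℂ) (g (Rechart.out L.toHomeomorph M x)) ∘ g ∘ (extChartAt 𝓘(ℂ, E) (Rechart.out L.toHomeomorph M x)).symm =
        g ∘ (chartAt E (Rechart.out L.toHomeomorph M x)).symm := by
      ext y; simp
    have e2 : (extChartAt 𝓘(ℂ, E) (Rechart.out L.toHomeomorph M x)).symm ⁻¹' s ∩ range (𝓘(ℂ, E)) =
        (chartAt E (Rechart.out L.toHomeomorph M x)).symm ⁻¹' s := by
      ext y; simp
    have e3 : extChartAt 𝓘(ℂ, E) (Rechart.out L.toHomeomorph M x) (Rechart.out L.toHomeomorph M x) =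
        chartAt E (Rechart.out L.toHomeomorph M x) (Rechart.out L.toHomeomorph M x) := by simp
    rw [e1, e2, e3] at hgd
    exact hgd
  -- conjugate by `L⁻¹` and `conj`
  have hB : ∀ (a : ℂ) (w : ℂ), (Complex.conjCLE : ℂ →L[ℝ] ℂ) (a • w) = conj a • (Complex.conjCLE : ℂ →L[ℝ] ℂ) w := fun a w ↦ by
    simp
  have key := DifferentiableWithinAt.antilinear_conj (h := g ∘ (chartAt E (Rechart.out L.toHomeomorph M x)).symm)
    (s := (chartAt E (Rechart.out L.toHomeomorph M x)).symm ⁻¹' s) (L.symm : E →L[ℝ] E)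
    (antilinear_symm L hL) (Complex.conjCLE : ℂ →L[ℝ] ℂ) hB (x₁ := L (chartAt E (Rechart.out L.toHomeomorph M x) (Rechart.out L.toHomeomorph M x)))
    (by rw [ContinuousLinearEquiv.coe_coe, L.symm_apply_apply]; exact hgd')
  rw [Rechart.extChartAt_symm_coe_linear (𝕜 := ℂ) L x]
  have e3 : extChartAt 𝓘(ℂ, E) x x = L (chartAt E (Rechart.out L.toHomeomorph M x) (Rechart.out L.toHomeomorph M x)) := by
    rw [Rechart.extChartAt_coe_linear]; rfl
  have e1 : extChartAt 𝓘(ℂ, ℂ) ((starRingEnd ℂ ∘ g ∘ Rechart.out L.toHomeomorph M) x) ∘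
      (starRingEnd ℂ ∘ g ∘ Rechart.out L.toHomeomorph M) ∘
        (Rechart.into L.toHomeomorph M ∘ (chartAt E (Rechart.out L.toHomeomorph M x)).symm ∘ L.symm) =
      (Complex.conjCLE : ℂ →L[ℝ] ℂ) ∘ (g ∘ (chartAt E (Rechart.out L.toHomeomorph M x)).symm) ∘ (L.symm : E →L[ℝ] E) := by
    ext y
    simp only [comp_apply, extChartAt_self_apply, modelWithCornersSelf_coe, id_eq, Rechart.out_into]
    rfl
  have e2 : (Rechart.into L.toHomeomorph M ∘ (chartAt E (Rechart.out L.toHomeomorph M x)).symm ∘ L.symm) ⁻¹'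
        (Rechart.out L.toHomeomorph M ⁻¹' s) ∩ range (𝓘(ℂ, E)) =
      (L.symm : E →L[ℝ] E) ⁻¹' ((chartAt E (Rechart.out L.toHomeomorph M x)).symm ⁻¹' s) := by
    rw [modelWithCornersSelf_coe, range_id, inter_univ]
    rfl
  rw [e1, e2, e3]
  exact key

/-- Set form: `conj ∘ g ∘ out` is holomorphic on `out ⁻¹' U` when `g` is holomorphic on `U ⊆ M`. [cite: VoisinHodgeI2002, §6.1.2] -/
theorem mdifferentiableOn_conj_comp_out {g : M → ℂ} {U : Set M} (hg : MDifferentiableOn 𝓘(ℂ, E) 𝓘(ℂ, ℂ) g U) :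
    MDifferentiableOn 𝓘(ℂ, E) 𝓘(ℂ, ℂ) (starRingEnd ℂ ∘ g ∘ Rechart.out L.toHomeomorph M) (Rechart.out L.toHomeomorph M ⁻¹' U) :=
  fun _ hx ↦ mdifferentiableWithinAt_conj_comp_out L hL (hg _ hx)

end Holomorphic

end Literature.NumberTheory.Transcendental

end
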